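import Summits.CriticalPhenomena.PercolationContinuityZ3.Theorems.SahiGridPatternOrderNTensor

/-!
# The order-`n` pattern functional is invariant under permuting the axes of the small cube

Support file (Sahi cell `prim-sahi`, seat `prim-sahi-typer`, generation 26; `--supports stmt-CriticalPhenomena-4575`).  One bookkeeping
definition (`axisRelab`), pure proofs, no `sorry`, standard axioms.

Together with the slot symmetry `sStarN_comp_perm` (…OrderNSymmetric) and the value relabelling `sStarN_relab` (…OrderNStrata) this is the
full symmetry group used to reduce certificate programmes to orbit representatives (at `(n,d) = (4,2)`: the 70 up-sets of `[4]^2` give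
`1 324` orbits of PAIRS under slot swap × axis swap, for each of which an exact bilinear slice certificate exists — seat census, memo
FROM-prim-sahi-typer-gen26 §5b): **`sStarN_axisRelab : sStarN n d (axisRelab τ ∘ A) = sStarN n d A`** for every `τ ∈ S_d`, and axis
relabelling preserves up-sets (`isUpperSet_axisRelab`), so `PatternPosN n d` is a statement about `S_n × S_d`-orbits of up-set tuples
(`patternPosN_iff_axisRelab`). [this work]
-/

namespace Summit.CriticalPhenomena.PercolationContinuityZ3.Theorems.SahiGridPatternN

open Finset
open SahiCopyKernel (copyKernel incMatrix)
open scoped BigOperators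

variable {n d : ℕ}

/-- Relabel the axes by `τ`: `axisRelab τ S = {q : (a ↦ q (τ a)) ∈ S}`. [this work] -/
def axisRelab (τ : Equiv.Perm (Fin d)) (S : Finset (Pn n d)) : Finset (Pn n d) :=
  univ.filter fun q => (fun a => q (τ a)) ∈ S

/-- Axis relabelling preserves up-sets. [this work] -/
theorem isUpperSet_axisRelab (τ : Equiv.Perm (Fin d)) {S : Finset (Pn n d)} (hS : IsUpperSet (S : Set (Pn n d))) :
    IsUpperSet (axisRelab τ S : Set (Pn n d)) := by
  intro q q' hqq' hq
  rw [Finset.mem_coe] at hq ⊢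
  unfold axisRelab at hq ⊢
  rw [mem_filter] at hq ⊢
  exact ⟨mem_univ _, hS (fun a => hqq' (τ a)) hq.2⟩

/-- Axis relabelling is undone by the inverse permutation. [this work] -/
theorem axisRelab_symm_axisRelab (τ : Equiv.Perm (Fin d)) (S : Finset (Pn n d)) : axisRelab τ.symm (axisRelab τ S) = S := by
  ext q
  unfold axisRelab
  simp only [mem_filter, mem_univ, true_and, Equiv.symm_apply_apply]

/-- The incidence matrix of an axis-relabelled family at a pattern is that of the family at the relabelled pattern. [this work] -/
theorem incMatrix_axisRelab (τ : Equiv.Perm (Fin d)) (A : Fin n → Finset (Pn n d)) (π : Fin d → Equiv.Perm (Fin n)) :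
    incMatrix (fun i => axisRelab τ (A i)) (col π) = incMatrix A (col fun a => π (τ a)) := by
  funext i c
  unfold incMatrix axisRelab col
  simp only [mem_filter, mem_univ, true_and]

/-- **`sStarN` is invariant under permuting the axes.** [this work] -/
theorem sStarN_axisRelab (τ : Equiv.Perm (Fin d)) (A : Fin n → Finset (Pn n d)) :
    sStarN n d (fun i => axisRelab τ (A i)) = sStarN n d A := by
  unfold sStarN
  simp_rw [incMatrix_axisRelab]
  exact Fintype.sum_equiv (Equiv.piCongrLeft' (fun _ : Fin d => Equiv.Perm (Fin n)) τ.symm) _ _ fun π => rfl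

/-- `PatternPosN n d` may be checked on any system of representatives of the axis relabelling (with the slot symmetry
`sStarN_comp_perm`: of `S_n × S_d`-orbits). [this work] -/
theorem patternPosN_iff_axisRelab (τ : Equiv.Perm (Fin d)) :
    PatternPosN n d ↔ ∀ A : Fin n → Finset (Pn n d), (∀ i, IsUpperSet (A i : Set (Pn n d))) →
      0 ≤ sStarN n d (fun i => axisRelab τ (A i)) := by
  constructor
  · intro h A hA
    exact h _ fun i => isUpperSet_axisRelab τ (hA i)
  · intro h A hA
    have := h (fun i => axisRelab τ.symm (A i)) fun i => isUpperSet_axisRelab τ.symm (hA i)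
    simpa only [sStarN_axisRelab] using this

end Summit.CriticalPhenomena.PercolationContinuityZ3.Theorems.SahiGridPatternN
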